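import Literature.MathematicalPhysics.KineticTheory.FreeOscillatorScaling
import Literature.Analysis.ODE.LipschitzFlow
import Mathlib.Analysis.SpecialFunctions.SmoothTransition
import Mathlib.Analysis.Calculus.ContDiff.RCLike
import Mathlib.Analysis.SpecialFunctions.Complex.Arg
import Mathlib.Analysis.SpecialFunctions.ExpDeriv
import Mathlib.Analysis.Complex.RealDeriv
import Mathlib.MeasureTheory.Integral.IntervalIntegral.FundThmCalculus
import HarnessLib

/-!
# The free oscillator: the flow on the unit energy shell is one periodic orbit (HM09 §2–§3.1)

Trunk T-KINETIC (`Literature/MathematicalPhysics/KineticTheory`). Second brick of the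
formalisation of [HM09, Thm 5.6]. For the free oscillator `Ĥ(P,Q) = P²/2 + |Q|^{2k}/(2k)`,
`k > 3/2` (`FreeOscillatorScaling.lean`), [HM09, §2] uses that "the solution `(p̃, q̃)` [of
`ṗ = -q|q|^{2k-2}`, `q̇ = p` at energy `1`] is periodic, say with period `τ`", and [HM09, §3.1]
that the Liouville operator `X_Ĥ` restricted to the unit shell is conjugate to `ω(θ) d/dθ` with
`ω > 0` (one closed orbit). This file PROVES these facts:

* `cutField k = χ(Ĥ) • Y` — the Hamiltonian field `Y = (-|Q|^{2k-2}Q, P)` cut off away from the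
  unit shell (`χ = 1` on `{1/2 ≤ Ĥ ≤ 2}`, `χ = 0` on `{Ĥ ≤ 1/4} ∪ {Ĥ ≥ 4}`): `C²`, compactly
  supported, hence globally Lipschitz, with global flow `shellFlow` (the tree's `lipschitzFlow`),
  jointly `C²` in (point, time), preserving `Ĥ`, odd under `z ↦ -z`, and equal to the true
  Hamiltonian dynamics on the unit shell;
* the ROTATION ARGUMENT: along an orbit on the unit shell, `P + iQ = e^{R(t) + iθ(t)} (P₀ + iQ₀)`
  with `θ' = (P² + |Q|^{2k})/(P² + Q²) ≥ c₀ > 0`; a ray from the origin meets the shell once;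
  hence every point of the shell is reached from every other one (`exists_shellFlow_eq`) and the
  orbit of the base point `(√2, 0)` closes up: `shellPeriod` (`> 0`) is a common period of all
  points of the unit shell (`shellFlow_shellPeriod`).

No named facts are introduced.

## References

* M. Hairer, J. C. Mattingly, *Slow energy dissipation in anharmonic oscillator chains*,
  Comm. Pure Appl. Math. **62** (2009) 999–1032, arXiv:0712.3884, §2 (the periodic free motion
  `(p̃, q̃)`, display (e:simple)), §3.1 (conjugation of `X_Ĥ` to `ω(θ)∂_θ`).
  [cite: HairerMattingly2009, §2 and §3.1]
* S. Lang, *Differential and Riemannian Manifolds* (1995), Ch. IV §1 (flows; via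
  `Literature.Analysis.ODE.lipschitzFlow`).
-/

noncomputable section

open Set Filter Topology Metric Function
open scoped NNReal

namespace Literature.MathematicalPhysics.KineticTheory.FreeOscillator

open Literature.Analysis.ODE

variable {k : ℝ}

/-! ### A smooth plateau function -/

/-- A smooth plateau: `= 1` on `[1/2, 2]`, `= 0` on `(-∞, 1/4] ∪ [4, ∞)`, values in `[0,1]`. [folklore] -/
def plateau (s : ℝ) : ℝ := Real.smoothTransition (4 * s - 1) * Real.smoothTransition (2 - s / 2)

/-- The plateau equals `1` on `[1/2, 2]`. [folklore] -/
theorem plateau_of_mem {s : ℝ} (hs : s ∈ Icc (1 / 2 : ℝ) 2) : plateau s = 1 := by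
  rw [plateau, Real.smoothTransition.one_of_one_le (by linarith [hs.1]),
    Real.smoothTransition.one_of_one_le (by linarith [hs.2]), one_mul]

/-- The plateau vanishes on `(-∞, 1/4]`. [folklore] -/
theorem plateau_of_le {s : ℝ} (hs : s ≤ 1 / 4) : plateau s = 0 := by
  rw [plateau, Real.smoothTransition.zero_of_nonpos (by linarith), zero_mul]

/-- The plateau vanishes on `[4, ∞)`. [folklore] -/
theorem plateau_of_ge {s : ℝ} (hs : 4 ≤ s) : plateau s = 0 := by
  rw [plateau, Real.smoothTransition.zero_of_nonpos (x := 2 - s / 2) (by linarith), mul_zero]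

/-- The plateau is smooth. [folklore] -/
theorem contDiff_plateau {n : ℕ∞} : ContDiff ℝ n plateau := by
  unfold plateau
  exact (Real.smoothTransition.contDiff.comp ((contDiff_const.mul contDiff_id).sub contDiff_const)).mul
    (Real.smoothTransition.contDiff.comp (contDiff_const.sub (contDiff_id.div_const _)))

/-! ### The cut-off Hamiltonian field and its global flow -/

/-- The cut-off field `χ(Ĥ) • Y`, equal to the Hamiltonian field near the unit shell and
compactly supported away from the origin and infinity. [folklore] -/
def cutField (k : ℝ) (z : ℝ × ℝ) : ℝ × ℝ := plateau (hHat k z) • field k z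

/-- The cut-off field is the Hamiltonian field on `{1/2 ≤ Ĥ ≤ 2}`. [folklore] -/
theorem cutField_eq_field {z : ℝ × ℝ} (hz : hHat k z ∈ Icc (1 / 2 : ℝ) 2) :
    cutField k z = field k z := by
  rw [cutField, plateau_of_mem hz, one_smul]

/-- The cut-off field is the Hamiltonian field on the unit shell. [folklore] -/
theorem cutField_eq_field_of_mem {z : ℝ × ℝ} (hz : z ∈ unitShell k) : cutField k z = field k z :=
  cutField_eq_field (by rw [mem_unitShell.1 hz]; norm_num)

/-- The cut-off field is `C²` (`k > 3/2`). [folklore] -/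
theorem contDiff_cutField (hk : 3 / 2 < k) : ContDiff ℝ 2 (cutField k) :=
  ((contDiff_plateau (n := 2)).comp (contDiff_hHat hk)).smul (contDiff_field hk)

/-- The cut-off field vanishes on `{Ĥ ≥ 4}`. [folklore] -/
theorem cutField_eq_zero_of_le {z : ℝ × ℝ} (hz : 4 ≤ hHat k z) : cutField k z = 0 := by
  rw [cutField, plateau_of_ge hz, zero_smul]

/-- The cut-off field has compact support. [folklore] -/
theorem hasCompactSupport_cutField (hk : 0 < k) : HasCompactSupport (cutField k) :=
  HasCompactSupport.intro (isCompact_setOf_hHat_le hk 4) fun _ hz =>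
    cutField_eq_zero_of_le (le_of_not_ge hz)

/-- The cut-off field is odd. [folklore] -/
theorem cutField_neg (k : ℝ) (z : ℝ × ℝ) : cutField k (-z) = -cutField k z := by
  rw [cutField, cutField, hHat_neg, field_neg, smul_neg]

/-- Energy is conserved by the cut-off field too: `DĤ · (χ(Ĥ) Y) = 0`. [folklore] -/
theorem fderiv_hHat_cutField (hk : 1 < 2 * k) (z : ℝ × ℝ) : fderiv ℝ (hHat k) z (cutField k z) = 0 := by
  rw [cutField, map_smul, fderiv_hHat_field hk, smul_zero]

/-- The cut-off field is globally Lipschitz (`C¹` with compact support). [folklore] -/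
theorem exists_lipschitzWith_cutField (hk : 3 / 2 < k) : ∃ K : ℝ≥0, LipschitzWith K (cutField k) :=
  (contDiff_cutField hk).lipschitzWith_of_hasCompactSupport (hasCompactSupport_cutField (by linarith))
    (by norm_num)

/-- A Lipschitz constant of the cut-off field (by choice). [folklore] -/
def lipConst (hk : 3 / 2 < k) : ℝ≥0 := (exists_lipschitzWith_cutField hk).choose

/-- The chosen Lipschitz constant works. [folklore] -/
theorem lipschitzWith_cutField (hk : 3 / 2 < k) : LipschitzWith (lipConst hk) (cutField k) :=
  (exists_lipschitzWith_cutField hk).choose_spec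

/-- **The shell flow** `φ z t`: the global flow of the cut-off field (the free Hamiltonian dynamics
of [HM09, §2, (e:simple)] near the unit shell). [cite: HairerMattingly2009, §2 (e:simple)] -/
def shellFlow (hk : 3 / 2 < k) (z : ℝ × ℝ) (t : ℝ) : ℝ × ℝ :=
  lipschitzFlow (lipschitzWith_cutField hk) z t

variable (hk : 3 / 2 < k)

/-- The shell flow starts at the given point. [folklore] -/
@[simp] theorem shellFlow_zero (z : ℝ × ℝ) : shellFlow hk z 0 = z :=
  lipschitzFlow_zero (lipschitzWith_cutField hk) z

/-- The shell flow consists of integral curves of the cut-off field. [folklore] -/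
theorem hasDerivAt_shellFlow (z : ℝ × ℝ) (t : ℝ) :
    HasDerivAt (shellFlow hk z) (cutField k (shellFlow hk z t)) t :=
  hasDerivAt_lipschitzFlow (lipschitzWith_cutField hk) z t

/-- Flow lines are continuous in time. [folklore] -/
theorem continuous_shellFlow (z : ℝ × ℝ) : Continuous (shellFlow hk z) :=
  continuous_lipschitzFlow (lipschitzWith_cutField hk) z

/-- The group law of the shell flow. [folklore] -/
theorem shellFlow_add (z : ℝ × ℝ) (s t : ℝ) :
    shellFlow hk z (s + t) = shellFlow hk (shellFlow hk z s) t :=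
  lipschitzFlow_add (lipschitzWith_cutField hk) z s t

/-- **Joint `C²` regularity** of `(z, t) ↦ φ z t`. [cite: Lang1995, Ch. IV §1, Thm. 1.16] -/
theorem contDiff_shellFlow : ContDiff ℝ 2 fun p : (ℝ × ℝ) × ℝ => shellFlow hk p.1 p.2 :=
  contDiff_lipschitzFlow (contDiff_cutField hk) (by norm_num) _

/-- The shell flow is jointly continuous. [folklore] -/
theorem continuous_shellFlow_uncurry : Continuous fun p : (ℝ × ℝ) × ℝ => shellFlow hk p.1 p.2 :=
  (contDiff_shellFlow hk).continuous

/-- Uniqueness: an integral curve of the cut-off field is a flow line. [folklore] -/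
theorem eq_shellFlow_of_hasDerivAt {c : ℝ → ℝ × ℝ} (hc : ∀ t, HasDerivAt c (cutField k (c t)) t)
    (t : ℝ) : c t = shellFlow hk (c 0) t := by
  have ht : t ∈ Ioo (-(|t| + 1)) (|t| + 1) := by
    constructor <;> cases abs_cases t <;> linarith
  exact eqOn_lipschitzFlow (lipschitzWith_cutField hk) (γ := c) (a := -(|t| + 1)) (b := |t| + 1)
    ⟨by linarith [abs_nonneg t], by linarith [abs_nonneg t]⟩ (fun s _ => hc s) ht

/-- The flow is odd: `φ (-z) t = -φ z t` (the field is odd). [folklore] -/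
theorem shellFlow_neg (z : ℝ × ℝ) (t : ℝ) : shellFlow hk (-z) t = -shellFlow hk z t := by
  have h := eq_shellFlow_of_hasDerivAt hk (c := fun s => -shellFlow hk z s) (fun s => ?_) t
  · simpa using h.symm
  · have := (hasDerivAt_shellFlow hk z s).neg
    rwa [← cutField_neg] at this

/-- **Energy conservation** along the shell flow. [cite: HairerMattingly2009, §2] -/
theorem hHat_shellFlow (z : ℝ × ℝ) (t : ℝ) : hHat k (shellFlow hk z t) = hHat k z := by
  have hk1 : 1 < 2 * k := by linarith
  have hd : ∀ s, HasDerivAt (fun s => hHat k (shellFlow hk z s)) 0 s := fun s => by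
    have h := (hasFDerivAt_hHat hk1 (shellFlow hk z s)).comp_hasDerivAt s (hasDerivAt_shellFlow hk z s)
    refine h.congr_deriv ?_
    rw [← (hasFDerivAt_hHat hk1 (shellFlow hk z s)).fderiv]
    exact fderiv_hHat_cutField hk1 _
  have := is_const_of_deriv_eq_zero (f := fun s => hHat k (shellFlow hk z s))
    (fun s => (hd s).differentiableAt) (fun s => (hd s).deriv) t 0
  simpa using this

/-- The unit shell is invariant under the shell flow. [folklore] -/
theorem shellFlow_mem_unitShell {z : ℝ × ℝ} (hz : z ∈ unitShell k) (t : ℝ) :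
    shellFlow hk z t ∈ unitShell k := by
  rw [mem_unitShell, hHat_shellFlow hk, mem_unitShell.1 hz]

/-- Flow lines on the unit shell avoid the origin. [folklore] -/
theorem shellFlow_ne_zero {z : ℝ × ℝ} (hz : z ∈ unitShell k) (t : ℝ) : shellFlow hk z t ≠ 0 :=
  ne_zero_of_mem_unitShell (by linarith) (shellFlow_mem_unitShell hk hz t)

/-- On the unit shell the shell flow IS the Hamiltonian flow: `∂ₜ φ = Y(φ)`. [cite: HairerMattingly2009, §2 (e:simple)] -/
theorem hasDerivAt_shellFlow_field {z : ℝ × ℝ} (hz : z ∈ unitShell k) (t : ℝ) :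
    HasDerivAt (shellFlow hk z) (field k (shellFlow hk z t)) t := by
  rw [← cutField_eq_field_of_mem (shellFlow_mem_unitShell hk hz t)]
  exact hasDerivAt_shellFlow hk z t

/-- `Ṗ = -V'(Q)` along the flow on the unit shell. [folklore] -/
theorem hasDerivAt_shellFlow_fst {z : ℝ × ℝ} (hz : z ∈ unitShell k) (t : ℝ) :
    HasDerivAt (fun s => (shellFlow hk z s).1) (-dV k (shellFlow hk z t).2) t := by
  have h := ((hasDerivAt_shellFlow_field hk hz t).hasFDerivAt.fst).hasDerivAt
  simpa using h

/-- `Q̇ = P` along the flow on the unit shell. [folklore] -/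
theorem hasDerivAt_shellFlow_snd {z : ℝ × ℝ} (hz : z ∈ unitShell k) (t : ℝ) :
    HasDerivAt (fun s => (shellFlow hk z s).2) (shellFlow hk z t).1 t := by
  have h := ((hasDerivAt_shellFlow_field hk hz t).hasFDerivAt.snd).hasDerivAt
  simpa using h

/-! ### The rotation argument: the unit shell is one closed orbit -/

/-- The points of the plane as complex numbers: `(P, Q) ↦ P + iQ`. [folklore] -/
def toC (w : ℝ × ℝ) : ℂ := (w.1 : ℂ) + (w.2 : ℂ) * Complex.I

/-- Real part of `toC`. [folklore] -/
@[simp] theorem toC_re (w : ℝ × ℝ) : (toC w).re = w.1 := by simp [toC]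
/-- Imaginary part of `toC`. [folklore] -/
@[simp] theorem toC_im (w : ℝ × ℝ) : (toC w).im = w.2 := by simp [toC]

/-- `toC` is injective. [folklore] -/
theorem toC_injective : Function.Injective toC := fun w w' h =>
  Prod.ext (by simpa using congrArg Complex.re h) (by simpa using congrArg Complex.im h)

/-- `toC w = 0 ↔ w = 0`. [folklore] -/
theorem toC_eq_zero_iff {w : ℝ × ℝ} : toC w = 0 ↔ w = 0 := by
  rw [show (0 : ℂ) = toC 0 by simp [toC]]
  exact toC_injective.eq_iff

/-- `toC` is real-linear (scalars). [folklore] -/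
theorem toC_smul (r : ℝ) (w : ℝ × ℝ) : toC (r • w) = (r : ℂ) * toC w := by
  simp [toC, mul_add, mul_assoc]

/-- The angular velocity `ω(P,Q) = (P² + Q V'(Q))/(P² + Q²)` of the Hamiltonian motion, seen in
the complex plane `P + iQ`. [cite: HairerMattingly2009, §3.1 (the function ω(θ))] -/
def angVel (k : ℝ) (w : ℝ × ℝ) : ℝ := (w.1 ^ 2 + w.2 * dV k w.2) / (w.1 ^ 2 + w.2 ^ 2)

/-- The radial (logarithmic) velocity `ρ(P,Q) = (PQ - P V'(Q))/(P² + Q²)`. [folklore] -/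
def radVel (k : ℝ) (w : ℝ × ℝ) : ℝ := (w.1 * w.2 - w.1 * dV k w.2) / (w.1 ^ 2 + w.2 ^ 2)

/-- `P² + Q² > 0` off the origin. [folklore] -/
theorem sq_add_sq_pos {w : ℝ × ℝ} (hw : w ≠ 0) : 0 < w.1 ^ 2 + w.2 ^ 2 := by
  rcases ne_or_eq w.1 0 with h | h
  · positivity
  · have h2 : w.2 ≠ 0 := fun h2 => hw (Prod.ext h h2)
    positivity

/-- **Polar decomposition of the Hamiltonian field**: `Y(w) = (ρ(w) + iω(w)) · w` in `ℂ`
(`w ≠ 0`). [folklore] -/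
theorem toC_field (k : ℝ) {w : ℝ × ℝ} (hw : w ≠ 0) :
    toC (field k w) = ((radVel k w : ℂ) + (angVel k w : ℂ) * Complex.I) * toC w := by
  have hD := (sq_add_sq_pos hw).ne'
  apply Complex.ext
  · simp only [toC_re, field_fst, Complex.add_re, Complex.mul_re, Complex.ofReal_re, Complex.I_re,
      mul_zero, Complex.ofReal_im, Complex.I_im, mul_one, sub_self, add_zero, Complex.add_im,
      Complex.mul_im, zero_add, toC_im, radVel, angVel]
    field_simp
    ring
  · simp only [toC_im, field_snd, Complex.add_im, Complex.mul_im, Complex.ofReal_re, Complex.I_re,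
      mul_zero, Complex.ofReal_im, Complex.I_im, mul_one, sub_self, add_zero, Complex.add_re,
      Complex.mul_re, zero_add, toC_re, radVel, angVel]
    field_simp
    ring

/-- The angular velocity is continuous off the origin (`k ≥ 1`). [folklore] -/
theorem continuousOn_angVel (hk : 1 ≤ k) : ContinuousOn (angVel k) {0}ᶜ := by
  intro w hw
  have hD := (sq_add_sq_pos (show w ≠ 0 from hw)).ne'
  have hdV := continuous_dV hk
  have hc : ContinuousAt (angVel k) w := by
    unfold angVel
    exact ContinuousAt.div (by fun_prop) (by fun_prop) hD
  exact hc.continuousWithinAt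

/-- The radial velocity is continuous off the origin (`k ≥ 1`). [folklore] -/
theorem continuousOn_radVel (hk : 1 ≤ k) : ContinuousOn (radVel k) {0}ᶜ := by
  intro w hw
  have hD := (sq_add_sq_pos (show w ≠ 0 from hw)).ne'
  have hdV := continuous_dV hk
  have hc : ContinuousAt (radVel k) w := by
    unfold radVel
    exact ContinuousAt.div (by fun_prop) (by fun_prop) hD
  exact hc.continuousWithinAt

/-- A bound for the norm on the unit shell. [folklore] -/
def shellBound (k : ℝ) : ℝ := max (Real.sqrt (2 * 1)) ((2 * k * 1) ^ (1 / (2 * k)))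

/-- `‖w‖ ≤ B` on the unit shell. [folklore] -/
theorem norm_le_shellBound (hk : 0 < k) {w : ℝ × ℝ} (hw : w ∈ unitShell k) : ‖w‖ ≤ shellBound k :=
  norm_le_of_hHat_le hk (le_of_eq (mem_unitShell.1 hw))

/-- `B > 0`. [folklore] -/
theorem shellBound_pos (k : ℝ) : 0 < shellBound k :=
  lt_max_of_lt_left (Real.sqrt_pos.2 (by norm_num))

/-- The lower bound `c₀ = 1/B²` for the angular velocity on the unit shell. [folklore] -/
def rotLB (k : ℝ) : ℝ := 1 / shellBound k ^ 2

/-- `c₀ > 0`. [folklore] -/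
theorem rotLB_pos (k : ℝ) : 0 < rotLB k := by
  unfold rotLB; have := shellBound_pos k; positivity

/-- **The angular velocity is bounded below on the unit shell**: `ω ≥ 1/B² > 0` (`k ≥ 1`):
numerator `P² + |Q|^{2k} ≥ 2Ĥ = 2`, denominator `P² + Q² ≤ 2B²`. [cite: HairerMattingly2009, §3.1] -/
theorem rotLB_le_angVel (hk : 1 ≤ k) {w : ℝ × ℝ} (hw : w ∈ unitShell k) : rotLB k ≤ angVel k w := by
  have hk0 : 0 < k := by linarith
  have hw0 : w ≠ 0 := ne_zero_of_mem_unitShell hk0 hw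
  have hD := sq_add_sq_pos hw0
  have hB := norm_le_shellBound hk0 hw
  have h1 : |w.1| ≤ shellBound k := (norm_fst_le w).trans hB
  have h2 : |w.2| ≤ shellBound k := (norm_snd_le w).trans hB
  have hnum : 2 ≤ w.1 ^ 2 + w.2 * dV k w.2 := by
    rw [mul_dV (by linarith) w.2]
    have hH : w.1 ^ 2 / 2 + |w.2| ^ (2 * k) / (2 * k) = 1 := mem_unitShell.1 hw
    have hle : |w.2| ^ (2 * k) / (2 * k) ≤ |w.2| ^ (2 * k) / 2 :=
      div_le_div_of_nonneg_left (Real.rpow_nonneg (abs_nonneg _) _) (by norm_num) (by linarith)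
    linarith
  have hden : w.1 ^ 2 + w.2 ^ 2 ≤ 2 * shellBound k ^ 2 := by
    have h1' : w.1 ^ 2 ≤ shellBound k ^ 2 := by
      rw [← sq_abs]; exact pow_le_pow_left₀ (abs_nonneg _) h1 2
    have h2' : w.2 ^ 2 ≤ shellBound k ^ 2 := by
      rw [← sq_abs]; exact pow_le_pow_left₀ (abs_nonneg _) h2 2
    linarith
  rw [rotLB, angVel, div_le_div_iff₀ (pow_pos (shellBound_pos k) 2) hD]
  nlinarith

section Rotation

variable {z : ℝ × ℝ}

/-- The accumulated rotation angle `θ(t) = ∫₀ᵗ ω(φ_s z) ds`. [folklore] -/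
def rotAngle (z : ℝ × ℝ) (t : ℝ) : ℝ := ∫ s in (0 : ℝ)..t, angVel k (shellFlow hk z s)

/-- The accumulated logarithmic radius `R(t) = ∫₀ᵗ ρ(φ_s z) ds`. [folklore] -/
def rotRad (z : ℝ × ℝ) (t : ℝ) : ℝ := ∫ s in (0 : ℝ)..t, radVel k (shellFlow hk z s)

/-- `t ↦ ω(φ_t z)` is continuous for `z` on the unit shell. [folklore] -/
theorem continuous_angVel_shellFlow (hz : z ∈ unitShell k) :
    Continuous fun s => angVel k (shellFlow hk z s) :=
  (continuousOn_angVel (by linarith)).comp_continuous (continuous_shellFlow hk z)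
    fun s => shellFlow_ne_zero hk hz s

/-- `t ↦ ρ(φ_t z)` is continuous for `z` on the unit shell. [folklore] -/
theorem continuous_radVel_shellFlow (hz : z ∈ unitShell k) :
    Continuous fun s => radVel k (shellFlow hk z s) :=
  (continuousOn_radVel (by linarith)).comp_continuous (continuous_shellFlow hk z)
    fun s => shellFlow_ne_zero hk hz s

/-- `θ' = ω(φ_t z)` (fundamental theorem of calculus). [folklore] -/
theorem hasDerivAt_rotAngle (hz : z ∈ unitShell k) (t : ℝ) :
    HasDerivAt (rotAngle hk z) (angVel k (shellFlow hk z t)) t :=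
  intervalIntegral.integral_hasDerivAt_right
    ((continuous_angVel_shellFlow hk hz).intervalIntegrable _ _)
    ((continuous_angVel_shellFlow hk hz).stronglyMeasurableAtFilter _ _)
    (continuous_angVel_shellFlow hk hz).continuousAt

/-- `R' = ρ(φ_t z)` (fundamental theorem of calculus). [folklore] -/
theorem hasDerivAt_rotRad (hz : z ∈ unitShell k) (t : ℝ) :
    HasDerivAt (rotRad hk z) (radVel k (shellFlow hk z t)) t :=
  intervalIntegral.integral_hasDerivAt_right
    ((continuous_radVel_shellFlow hk hz).intervalIntegrable _ _)
    ((continuous_radVel_shellFlow hk hz).stronglyMeasurableAtFilter _ _)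
    (continuous_radVel_shellFlow hk hz).continuousAt

/-- The rotation angle is continuous. [folklore] -/
theorem continuous_rotAngle (hz : z ∈ unitShell k) : Continuous (rotAngle hk z) :=
  continuous_iff_continuousAt.2 fun t => (hasDerivAt_rotAngle hk hz t).continuousAt

/-- `θ(0) = 0`. [folklore] -/
@[simp] theorem rotAngle_zero : rotAngle hk z 0 = 0 := by simp [rotAngle]
/-- `R(0) = 0`. [folklore] -/
@[simp] theorem rotRad_zero : rotRad hk z 0 = 0 := by simp [rotRad]

/-- `θ(t) ≥ c₀ t` for `t ≥ 0`. [folklore] -/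
theorem mul_le_rotAngle (hz : z ∈ unitShell k) {t : ℝ} (ht : 0 ≤ t) : rotLB k * t ≤ rotAngle hk z t := by
  have h := intervalIntegral.integral_mono_on ht (intervalIntegrable_const (μ := MeasureTheory.volume))
    ((continuous_angVel_shellFlow hk hz).intervalIntegrable _ _)
    (fun s _ => rotLB_le_angVel (by linarith) (shellFlow_mem_unitShell hk hz s))
  simpa [rotAngle, mul_comm] using h

/-- Every nonnegative angle is reached (intermediate value theorem). [folklore] -/
theorem exists_rotAngle_eq (hz : z ∈ unitShell k) {d : ℝ} (hd : 0 ≤ d) :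
    ∃ t, 0 ≤ t ∧ rotAngle hk z t = d := by
  have hc := rotLB_pos k
  have h1 : d ≤ rotAngle hk z (d / rotLB k) := by
    have := mul_le_rotAngle hk hz (t := d / rotLB k) (div_nonneg hd hc.le)
    rwa [mul_div_cancel₀ _ hc.ne'] at this
  obtain ⟨t, ht, heq⟩ := intermediate_value_Icc (div_nonneg hd hc.le)
    (continuous_rotAngle hk hz).continuousOn ⟨by simpa using hd, h1⟩
  exact ⟨t, ht.1, heq⟩

/-- The complexified orbit `ζ(t) = P(t) + iQ(t)` solves `ζ' = (ρ + iω) ζ`. [folklore] -/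
theorem hasDerivAt_toC_shellFlow (hz : z ∈ unitShell k) (t : ℝ) :
    HasDerivAt (fun s => toC (shellFlow hk z s))
      (((radVel k (shellFlow hk z t) : ℂ) + (angVel k (shellFlow hk z t) : ℂ) * Complex.I) *
        toC (shellFlow hk z t)) t := by
  rw [← toC_field k (shellFlow_ne_zero hk hz t)]
  unfold toC
  exact ((hasDerivAt_shellFlow_fst hk hz t).ofReal_comp).add
    (((hasDerivAt_shellFlow_snd hk hz t).ofReal_comp).mul_const Complex.I)

/-- **Integration of the rotation**: `P(t) + iQ(t) = (P₀ + iQ₀) e^{R(t) + iθ(t)}` along the orbit of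
`z = (P₀, Q₀)` on the unit shell. [folklore] -/
theorem toC_shellFlow (hz : z ∈ unitShell k) (t : ℝ) :
    toC (shellFlow hk z t) =
      toC z * Complex.exp ((rotRad hk z t : ℂ) + (rotAngle hk z t : ℂ) * Complex.I) := by
  -- `h(s) = ζ(s) e^{-(R(s) + iθ(s))}` has zero derivative
  set g : ℝ → ℂ := fun s => -((rotRad hk z s : ℂ) + (rotAngle hk z s : ℂ) * Complex.I) with hg
  have hg' : ∀ s, HasDerivAt g
      (-((radVel k (shellFlow hk z s) : ℂ) + (angVel k (shellFlow hk z s) : ℂ) * Complex.I)) s :=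
    fun s => (((hasDerivAt_rotRad hk hz s).ofReal_comp).add
      (((hasDerivAt_rotAngle hk hz s).ofReal_comp).mul_const Complex.I)).neg
  set h : ℝ → ℂ := fun s => toC (shellFlow hk z s) * Complex.exp (g s) with hh
  have hd : ∀ s, HasDerivAt h 0 s := fun s => by
    have := (hasDerivAt_toC_shellFlow hk hz s).mul ((hg' s).cexp)
    refine this.congr_deriv ?_
    ring
  have hconst := is_const_of_deriv_eq_zero (fun s => (hd s).differentiableAt) (fun s => (hd s).deriv) t 0
  simp only [hh, hg, shellFlow_zero, rotRad_zero, rotAngle_zero, Complex.ofReal_zero, zero_mul,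
    add_zero, neg_zero, Complex.exp_zero, mul_one] at hconst
  -- `ζ(t) e^{-X} = ζ(0)` ⇒ `ζ(t) = ζ(0) e^{X}`
  have hexp : Complex.exp (-((rotRad hk z t : ℂ) + (rotAngle hk z t : ℂ) * Complex.I)) *
      Complex.exp ((rotRad hk z t : ℂ) + (rotAngle hk z t : ℂ) * Complex.I) = 1 := by
    rw [← Complex.exp_add, neg_add_cancel, Complex.exp_zero]
  calc toC (shellFlow hk z t)
      = toC (shellFlow hk z t) * (Complex.exp (-((rotRad hk z t : ℂ) + (rotAngle hk z t : ℂ) * Complex.I)) *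
          Complex.exp ((rotRad hk z t : ℂ) + (rotAngle hk z t : ℂ) * Complex.I)) := by rw [hexp, mul_one]
    _ = toC z * Complex.exp ((rotRad hk z t : ℂ) + (rotAngle hk z t : ℂ) * Complex.I) := by
        rw [← mul_assoc, hconst]

end Rotation

/-- `Ĥ` increases strictly along rays: `Ĥ(r w) > 1` for `w` on the unit shell and `r > 1`. [folklore] -/
theorem one_lt_hHat_smul (hk : 0 < k) {w : ℝ × ℝ} (hw : w ∈ unitShell k) {r : ℝ} (hr : 1 < r) :
    1 < hHat k (r • w) := by
  have hr0 : 0 < r := by linarith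
  have hH : w.1 ^ 2 / 2 + |w.2| ^ (2 * k) / (2 * k) = 1 := mem_unitShell.1 hw
  have ha : 0 ≤ w.1 ^ 2 / 2 := by positivity
  have hb : 0 ≤ |w.2| ^ (2 * k) / (2 * k) := by positivity
  have hr2 : 1 < r ^ 2 := by nlinarith
  have hr2k : 1 < r ^ (2 * k) := Real.one_lt_rpow hr (by linarith)
  have hcalc : hHat k (r • w) = r ^ 2 * (w.1 ^ 2 / 2) + r ^ (2 * k) * (|w.2| ^ (2 * k) / (2 * k)) := by
    simp only [hHat, Prod.smul_fst, Prod.smul_snd, smul_eq_mul, abs_mul, abs_of_pos hr0,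
      Real.mul_rpow hr0.le (abs_nonneg _)]
    ring
  rw [hcalc]
  set m := min (r ^ 2) (r ^ (2 * k)) with hm
  have hm1 : 1 < m := lt_min hr2 hr2k
  have : m * (w.1 ^ 2 / 2) + m * (|w.2| ^ (2 * k) / (2 * k)) ≤
      r ^ 2 * (w.1 ^ 2 / 2) + r ^ (2 * k) * (|w.2| ^ (2 * k) / (2 * k)) :=
    add_le_add (mul_le_mul_of_nonneg_right (min_le_left _ _) ha)
      (mul_le_mul_of_nonneg_right (min_le_right _ _) hb)
  nlinarith

/-- **A ray from the origin meets the unit shell exactly once**: if `w, w'` lie on the unit shell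
and `w' = r w` with `r > 0` then `w' = w`. [folklore] -/
theorem eq_of_toC_eq_mul (hk : 0 < k) {w w' : ℝ × ℝ} (hw : w ∈ unitShell k) (hw' : w' ∈ unitShell k)
    {r : ℝ} (hr : 0 < r) (h : toC w' = (r : ℂ) * toC w) : w' = w := by
  have hsmul : w' = r • w := toC_injective (by rw [h, toC_smul])
  rcases lt_trichotomy r 1 with hr1 | rfl | hr1
  · exfalso
    have hinv : 1 < r⁻¹ := one_lt_inv₀ hr |>.2 hr1
    have hw_eq : w = r⁻¹ • w' := by rw [hsmul, smul_smul, inv_mul_cancel₀ hr.ne', one_smul]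
    have := one_lt_hHat_smul hk hw' hinv
    rw [← hw_eq, mem_unitShell.1 hw] at this
    exact lt_irrefl _ this
  · rw [hsmul, one_smul]
  · exfalso
    have := one_lt_hHat_smul hk hw hr1
    rw [← hsmul, mem_unitShell.1 hw'] at this
    exact lt_irrefl _ this

section Period

variable {z y : ℝ × ℝ}

/-- **Every orbit on the unit shell is closed**: there is `T > 0` with `φ z T = z` (the angle
`θ(T) = 2π` is reached, and then the point is back on its own ray). [cite: HairerMattingly2009, §2 ("the solution (p̃, q̃) is periodic")] -/
theorem exists_pos_shellFlow_eq_self (hz : z ∈ unitShell k) : ∃ T, 0 < T ∧ shellFlow hk z T = z := by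
  have hk0 : 0 < k := by linarith
  obtain ⟨T, hT0, hT⟩ := exists_rotAngle_eq hk hz (d := 2 * Real.pi) (by positivity)
  have hTpos : 0 < T := by
    rcases hT0.lt_or_eq with h | h
    · exact h
    · exfalso
      rw [← h, rotAngle_zero] at hT
      linarith [Real.pi_pos]
  refine ⟨T, hTpos, eq_of_toC_eq_mul hk0 hz (shellFlow_mem_unitShell hk hz T) (Real.exp_pos (rotRad hk z T)) ?_⟩
  rw [toC_shellFlow hk hz T, hT, Complex.exp_add, Complex.ofReal_mul, Complex.ofReal_ofNat,
    Complex.exp_two_pi_mul_I, mul_one, Complex.ofReal_exp]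
  ring

/-- **The unit shell is a single orbit**: every point of the shell is reached from every other
one in nonnegative time. [cite: HairerMattingly2009, §3.1 (conjugation of X_Ĥ to ω(θ)∂_θ on S¹)] -/
theorem exists_shellFlow_eq (hz : z ∈ unitShell k) (hy : y ∈ unitShell k) :
    ∃ t, 0 ≤ t ∧ shellFlow hk z t = y := by
  have hk0 : 0 < k := by linarith
  have hz0 : toC z ≠ 0 := fun h => ne_zero_of_mem_unitShell hk0 hz (toC_eq_zero_iff.1 h)
  have hy0 : toC y ≠ 0 := fun h => ne_zero_of_mem_unitShell hk0 hy (toC_eq_zero_iff.1 h)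
  set q : ℂ := toC y / toC z with hq
  have hq0 : q ≠ 0 := div_ne_zero hy0 hz0
  have hqn : 0 < ‖q‖ := norm_pos_iff.2 hq0
  set d : ℝ := Complex.arg q + 2 * Real.pi with hd
  have hdpos : 0 ≤ d := by
    have := Complex.neg_pi_lt_arg q
    rw [hd]; linarith [Real.pi_pos]
  obtain ⟨t, ht0, ht⟩ := exists_rotAngle_eq hk hz hdpos
  refine ⟨t, ht0, eq_of_toC_eq_mul hk0 hy (shellFlow_mem_unitShell hk hz t)
    (div_pos (Real.exp_pos (rotRad hk z t)) hqn) ?_⟩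
  have hexp : Complex.exp ((d : ℂ) * Complex.I) = q / (‖q‖ : ℂ) := by
    rw [hd, Complex.ofReal_add, add_mul, Complex.exp_add, Complex.ofReal_mul, Complex.ofReal_ofNat,
      Complex.exp_two_pi_mul_I, mul_one, eq_div_iff (by exact_mod_cast hqn.ne'), mul_comm]
    exact Complex.norm_mul_exp_arg_mul_I q
  rw [toC_shellFlow hk hz t, ht, Complex.exp_add, hexp, hq, Complex.ofReal_div, Complex.ofReal_exp]
  field_simp

/-- The base point `(√2, 0)` of the unit shell. [folklore] -/
def basePt : ℝ × ℝ := (Real.sqrt 2, 0)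

/-- The base point lies on the unit shell. [folklore] -/
theorem basePt_mem_unitShell (hk : 0 < k) : basePt ∈ unitShell k := sqrt_two_zero_mem_unitShell hk

/-- **The period** `T₁ > 0` of the free motion on the unit shell (the return time of the base
point; a common period of all points of the shell, `shellFlow_shellPeriod`). HM's `τ`.
[cite: HairerMattingly2009, §2 ("periodic, say with period τ")] -/
def shellPeriod : ℝ :=
  (exists_pos_shellFlow_eq_self hk (basePt_mem_unitShell (by linarith))).choose

/-- `T₁ > 0`. [folklore] -/
theorem shellPeriod_pos : 0 < shellPeriod hk :=
  (exists_pos_shellFlow_eq_self hk (basePt_mem_unitShell (by linarith))).choose_spec.1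

/-- The base point returns after time `T₁`. [folklore] -/
theorem shellFlow_basePt_shellPeriod : shellFlow hk basePt (shellPeriod hk) = basePt :=
  (exists_pos_shellFlow_eq_self hk (basePt_mem_unitShell (by linarith))).choose_spec.2

/-- Every point of the unit shell lies on the orbit of the base point. [folklore] -/
theorem exists_shellFlow_basePt_eq (hy : y ∈ unitShell k) : ∃ s, 0 ≤ s ∧ shellFlow hk basePt s = y :=
  exists_shellFlow_eq hk (basePt_mem_unitShell (by linarith)) hy

/-- **`T₁` is a period of every point of the unit shell.** [cite: HairerMattingly2009, §2] -/
theorem shellFlow_shellPeriod (hy : y ∈ unitShell k) : shellFlow hk y (shellPeriod hk) = y := by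
  obtain ⟨s, -, rfl⟩ := exists_shellFlow_basePt_eq hk hy
  rw [← shellFlow_add hk, add_comm, shellFlow_add hk, shellFlow_basePt_shellPeriod hk]

/-- `φ y (t + T₁) = φ y t` on the unit shell. [folklore] -/
theorem shellFlow_add_shellPeriod (hy : y ∈ unitShell k) (t : ℝ) :
    shellFlow hk y (t + shellPeriod hk) = shellFlow hk y t := by
  rw [add_comm, shellFlow_add hk, shellFlow_shellPeriod hk hy]

/-- Periodicity of the orbits on the unit shell. [cite: HairerMattingly2009, §2] -/
theorem periodic_shellFlow (hy : y ∈ unitShell k) : Function.Periodic (shellFlow hk y) (shellPeriod hk) :=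
  fun t => shellFlow_add_shellPeriod hk hy t

/-- The unit shell is symmetric under `z ↦ -z`. [folklore] -/
theorem neg_mem_unitShell (hy : y ∈ unitShell k) : -y ∈ unitShell k := by
  rw [mem_unitShell, hHat_neg]; exact hy

/-- The antipode `-y` lies on the orbit of `y`. [folklore] -/
theorem exists_shellFlow_eq_neg (hy : y ∈ unitShell k) : ∃ s, 0 ≤ s ∧ shellFlow hk y s = -y :=
  exists_shellFlow_eq hk hy (neg_mem_unitShell hy)

end Period

end Literature.MathematicalPhysics.KineticTheory.FreeOscillator

end
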